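import Summits.Ventures.CertifiedManyBodySolver.Observables.RungLeaves
import Summits.Ventures.CertifiedManyBodySolver.Observables.StiffnessTLOddMomentOrbitRow
import HarnessLib

/-!
# Ventures/CertifiedManyBodySolver — Observables: the stiffness rung leaf fed by a certified `stiffK3` edge

HONEST FRAMING: one-sided CEILINGS on the flux stiffness (helicity modulus / superfluid weight); not
a superconductivity verdict; no stiffness floor follows from equal-time data and an energy window.

Cell `hubbard-obs` (D-0042), seat p2 (stiffness). The D-0061 leaf `M3ObsStiffnessCeilingAt_tp0 c`
(`Observables/RungLeaves.lean`, obs-lit p405324: "every uniform flux stiffness of the `(N_L, 0)` sectors of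
`hubbardTorus 2 L 1 8` at density `7/8` is `≤ c`") is discharged, so far, by the energy chord (leaf of record,
`c ≈ 0.3748013`) and by any certified kinetic floor through `M3ObsStiffnessCeilingAt_tp0_of_kineticDensity_ge`
(the `kinlo` edge). This file adds the one-line discharger for the odd-moment (Krylov-3) row `R-K3-TL`:
a certified registry-shaped orbit row `M3CorrOrbitLowerRow 0 u r S (box 2 7) (−oddMomentObs 8 λ)` (the `up`
edge of the `stiffK3` objective `F_λ = ½kx + 2λU·d1U + λ²(U²m3T + U³m3U)` on the EXT5-L⁺ host, HOME/hubbard-obs-p2/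
ops/tl/patches_EXT5Lp/) together with the energy cap `e₀(8, 7/8, 0) ≤ u` (node #354) gives
`M3ObsStiffnessCeilingAt_tp0 c` for every `c ≥ −r` (`m3_tp0_fluxStiffness_le_of_oddMoment_orbitLowerRow_neg`,
`Observables/StiffnessTLOddMomentOrbitRow.lean`). No new definition, no new fact, zero computation.

References: [Kohn1964]; [ScalapinoWhiteZhang1993] §II; [Lipparini2008] eq. (8.30).
-/

noncomputable section

namespace Summit.Ventures.CertifiedManyBodySolver.Observables

open Literature.MathematicalPhysics.QuantumLattice
open Literature.MathematicalPhysics.QuantumLattice.ThermodynamicLimit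
open Literature.Probability.LatticeModels
open Filter Topology

/-- **Leaf discharger for a certified `stiffK3` edge.** If the registry-shaped orbit row
`M3CorrOrbitLowerRow 0 u r S (box 2 7) (−oddMomentObs 8 λ)` holds (`S ⊆ D₄` nonempty) and the energy cap
`e₀(8, 7/8, 0) ≤ u` is certified, then the stiffness leaf `M3ObsStiffnessCeilingAt_tp0 c` holds for every
`c ≥ −r` (tree units; `D_s^{HVR} ≤ c/2`, `D^{SWZ}/(πe²) ≤ 2c`). [cite: ScalapinoWhiteZhang1993, §II] -/
theorem M3ObsStiffnessCeilingAt_tp0_of_oddMoment_orbitLowerRow (lam : ℝ) {u r : ℚ}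
    (S : Finset (DihedralGroup 4)) (hS : S.Nonempty)
    (hrow : M3CorrOrbitLowerRow 0 u r S (box 2 7) (-oddMomentObs 8 lam))
    (hu : energyDensityTT' 1 0 8 (7 / 8) ≤ ((u : ℚ) : ℝ)) (c : ℚ) (hc : -r ≤ c) :
    M3ObsStiffnessCeilingAt_tp0 c :=
  fun ρs θ₀ _ hθ₀ L₀ hst =>
    (m3_tp0_fluxStiffness_le_of_oddMoment_orbitLowerRow_neg lam S hS hrow hu ρs θ₀ hθ₀ L₀ hst).trans
      (by exact_mod_cast hc)

/-- The same with the full point group `S = D₄` (the host's reduction group) — the form the node files of the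
cell state (`… Finset.univ Λ X`). [cite: ScalapinoWhiteZhang1993, §II] -/
theorem M3ObsStiffnessCeilingAt_tp0_of_oddMoment_orbitLowerRow_univ (lam : ℝ) {u r : ℚ}
    (hrow : M3CorrOrbitLowerRow 0 u r Finset.univ (box 2 7) (-oddMomentObs 8 lam))
    (hu : energyDensityTT' 1 0 8 (7 / 8) ≤ ((u : ℚ) : ℝ)) (c : ℚ) (hc : -r ≤ c) :
    M3ObsStiffnessCeilingAt_tp0 c :=
  M3ObsStiffnessCeilingAt_tp0_of_oddMoment_orbitLowerRow lam Finset.univ Finset.univ_nonempty hrow hu c hc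

end Summit.Ventures.CertifiedManyBodySolver.Observables

end
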